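import Literature.AlgebraicGeometry.Andre1996.MonodromyInvariantMotivatedClasses
import Literature.AlgebraicGeometry.HodgeTheory.FiniteEtaleCoverOfFiniteIndexSmooth
import HarnessLib

/-!
# André 1996, Cor. 5.1 over any smooth quasi-projective base WITHOUT the Riemann-existence hypothesis

Family `hodge`, layer `Literature/AlgebraicGeometry/Andre1996` (lane `lit-hodgefound`, Layer B,
DAG-B node **B3-15**). PROOF FILE: theorems only — no definition, no new named fact (D-0026; net
debt 0).

Source (Y. André, *Pour une théorie inconditionnelle des motifs*, Publ. Math. IHÉS 83 (1996),
Cor. 5.1, p. 26; held `paper:andre1996`, An p0023:5–14), verbatim: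

> **Corollaire 5.1.** — Soit `f : X → S` un morphisme projectif et lisse, `S` étant une variété
> algébrique complexe lisse connexe, et soit `s` un point de `S(ℂ)`. Soit `T` [...] un cycle motivé
> invariant sous un sous-groupe d'indice fini de `π₁(S(ℂ), s)`. Alors les translatés de `T` par
> transport parallèle en un point quelconque de `S(ℂ)` sont motivés. En particulier, pour tout
> `γ ∈ π₁(S(ℂ), s)`, `γT` est motivé.
>
> *Preuve.* Le sous-groupe d'indice fini définit un revêtement étale `S' → S` [...]

The tree's `Andre1996/MonodromyInvariantMotivatedClasses.lean` proves this corollary (single-degree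
Betti form on the real carriers) from the printed proof's inputs as named facts of the tree: the
global invariant cycle theorem (`deligne_globalInvariantCycles`, hypothesis `hGIC`), André's
deformation theorem 0.5 (`Andre1996_deformation`, hypothesis `h05`) and — for step 1, «le
sous-groupe d'indice fini définit un revêtement étale `S' → S`» — Riemann's existence theorem for
finite coverings of quasi-projective complex varieties (`FundamentalGroup.riemannExistence_finiteCovering`,
SGA 1 XII Thm. 5.1, hypothesis `hRE`); over a smooth CURVE or a compact pencil step 1 was already a
theorem. Since Riemann's existence theorem is a THEOREM of the tree over smooth irreducible
quasi-projective bases of EVERY dimension (`FundamentalGroup.riemannExistence_smooth`; finite-index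
form `HodgeTheory.exists_finiteEtale_of_finiteIndex_of_smooth`), and Cor. 5.1's base IS smooth
(«`S` étant une variété algébrique complexe lisse connexe»), the hypothesis `hRE` can be dropped:

* `transportFun_mem_motivatedClasses_of_finiteIndex'` — Cor. 5.1, transport form, from `hGIC` and
  `h05` ALONE (the tree's `transportFun_mem_motivatedClasses_of_finiteIndex` minus `hRE`);
* `transportFun_toPath_mem_motivatedClasses_of_finiteIndex'` — «en particulier, `γT` est motivé»;
* `mem_motivatedClasses_of_isContinuationAlong_of_finiteIndex'` — the flat-continuation form.

The statements are those of the unprimed namesakes with `hRE` removed; the proofs are the same, the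
named fact replaced by the theorem. The tree's `…_smoothCurve` and `…_compactPencil` forms are now
special cases of the primed theorems.

## References

* [Andre1996Motifs] Y. André, Pour une théorie inconditionnelle des motifs, Publ. Math. IHÉS 83
  (1996): Cor. 5.1 and its proof (p. 26), Thm. 0.5 (p. 8), §5.1 (p. 25).
* [SGA1] A. Grothendieck, M. Raynaud, Revêtements étales et groupe fondamental, LNM 224 (1971),
  Exp. XII Thm. 5.1 (smooth case: proved in the tree, `FundamentalGroup/RiemannExistenceSmooth.lean`).
* [DeligneHodgeII1971] P. Deligne, Théorie de Hodge II, Publ. Math. IHÉS 40 (1971), Thm. 4.1.1.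
* [Voisin2007HodgeLoci] C. Voisin, Hodge loci and absolute Hodge classes, Compositio Math. 143
  (2007), §3, proof of Prop. 0.7.

#harness_tags algebraic_geometry.hodge_conjecture, motives.motivated_cycles, algebraic_geometry.sga1
-/

noncomputable section

open CategoryTheory CategoryTheory.Limits AlgebraicGeometry MonoidalCategory
open _root_.Topology
open Literature.AlgebraicTopology.SingularHomology

namespace Literature.AlgebraicGeometry.Andre1996

open Literature.AlgebraicGeometry.Motives Literature.AlgebraicGeometry.HodgeTheory

/-- **André 1996, Cor. 5.1 (parallel transports of a finite-index-invariant motivated class are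
motivated), single-degree Betti form on the real carriers, GRANTED ONLY the global invariant cycle
theorem (`deligne_globalInvariantCycles`) and André's deformation theorem 0.5
(`Andre1996_deformation`)** — the tree's `transportFun_mem_motivatedClasses_of_finiteIndex` without
its Riemann-existence hypothesis `hRE`. Let `f : 𝒳 ⟶ S` be a smooth projective family of relative
dimension `n`, projective in Hartshorne's sense, over a smooth irreducible quasi-projective complex
`S`; `s ∈ S(ℂ)`; `T ∈ A_motᵖ(X_s)_ℂ = motivatedClasses n (fiberOver f s) p` a motivated class
invariant under the monodromy of a finite-index subgroup `H ≤ π₁(S(ℂ), s)`. Then for every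
`t ∈ S(ℂ)` and every homotopy class of paths `γ` from `s` to `t`, the parallel transport
`γ_* T ∈ H²ᵖ(X_t(ℂ); ℂ)` is motivated: «les translatés de `T` par transport parallèle en un point
quelconque de `S(ℂ)` sont motivés». Proof = the printed one: step 1 «le sous-groupe d'indice fini
définit un revêtement étale `S' → S`» is the tree's THEOREM `exists_finiteEtale_of_finiteIndex_of_smooth`
(SGA 1 XII Thm. 5.1 over the smooth base, `FundamentalGroup.riemannExistence_smooth`); steps 2–4
(base change, partie fixe on a smooth compactification, Thm. 0.5, path lifting) are
`transportFun_mem_motivatedClasses_of_finiteEtaleCover`.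
[cite: Andre1996Motifs, Cor. 5.1 and its proof (p. 26); Thm. 0.5 (p. 8)]
[cite: SGA1, Exp. XII Thm. 5.1] [cite: DeligneHodgeII1971, Théorème 4.1.1]
[cite: Voisin2007HodgeLoci, §3, proof of Prop. 0.7] -/
theorem transportFun_mem_motivatedClasses_of_finiteIndex'
    (hGIC : deligne_globalInvariantCycles) (h05 : Andre1996_deformation)
    {n : ℕ} {𝒳 S : SchemeOver ℂ} (f : 𝒳 ⟶ S) (hf : IsSmoothProjectiveFamily f n)
    (hι : ∃ (N : ℕ) (ι : 𝒳 ⟶ projectiveSpace N ℂ ⊗ S),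
      IsClosedImmersion ι.left ∧ ι ≫ CartesianMonoidalCategory.snd (projectiveSpace N ℂ) S = f)
    (hS : IsQuasiProjectiveOver S) [Smooth S.hom] [IrreducibleSpace S.left]
    (hU : IsCohomologicallyLocallyTrivialOn f (Set.univ : Set (ComplexPoints S)))
    {s : ComplexPoints S} {p : ℕ} {T : complexBetti (fiberOver f s) (2 * p)}
    (hT : T ∈ motivatedClasses n (fiberOver f s) p)
    (H : Subgroup (FundamentalGroup (Set.univ : Set (ComplexPoints S)) ⟨s, Set.mem_univ s⟩))
    [H.FiniteIndex]
    (hH : ∀ γ ∈ H, transportFun f (2 * p) hU (FundamentalGroup.toPath γ) T = T)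
    (t : ComplexPoints S)
    (γ : Path.Homotopic.Quotient (⟨s, Set.mem_univ s⟩ : (Set.univ : Set (ComplexPoints S)))
      ⟨t, Set.mem_univ t⟩) :
    transportFun f (2 * p) hU γ T ∈ motivatedClasses n (fiberOver f t) p := by
  -- Step 1 («le sous-groupe d'indice fini définit un revêtement étale `S' → S`»): Riemann
  -- existence, a THEOREM of the tree over the smooth irreducible quasi-projective `S`
  obtain ⟨S', g, s', hs, hgfin, hget, hS'pc, hloops⟩ :=
    exists_finiteEtale_of_finiteIndex_of_smooth S hS s H
  subst hs
  haveI := hgfin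
  haveI := hget
  haveI := hS'pc
  -- Steps 2–4
  exact transportFun_mem_motivatedClasses_of_finiteEtaleCover hGIC h05 f hf hι hS hU g s' hT
    (fun γ' ↦ hH _ (hloops γ')) t γ

/-- **André 1996, Cor. 5.1, «En particulier, pour tout `γ ∈ π₁(S(ℂ), s)`, `γT` est motivé»,
granted only `deligne_globalInvariantCycles` and `Andre1996_deformation`** — the tree's
`transportFun_toPath_mem_motivatedClasses_of_finiteIndex` without `hRE`: under the hypotheses of
`transportFun_mem_motivatedClasses_of_finiteIndex'`, the monodromy image `γ_* T` of `T` under EVERY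
element `γ` of the fundamental group (not only of `H`) is motivated.
[cite: Andre1996Motifs, Cor. 5.1 (p. 26)] -/
theorem transportFun_toPath_mem_motivatedClasses_of_finiteIndex'
    (hGIC : deligne_globalInvariantCycles) (h05 : Andre1996_deformation)
    {n : ℕ} {𝒳 S : SchemeOver ℂ} (f : 𝒳 ⟶ S) (hf : IsSmoothProjectiveFamily f n)
    (hι : ∃ (N : ℕ) (ι : 𝒳 ⟶ projectiveSpace N ℂ ⊗ S),
      IsClosedImmersion ι.left ∧ ι ≫ CartesianMonoidalCategory.snd (projectiveSpace N ℂ) S = f)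
    (hS : IsQuasiProjectiveOver S) [Smooth S.hom] [IrreducibleSpace S.left]
    (hU : IsCohomologicallyLocallyTrivialOn f (Set.univ : Set (ComplexPoints S)))
    {s : ComplexPoints S} {p : ℕ} {T : complexBetti (fiberOver f s) (2 * p)}
    (hT : T ∈ motivatedClasses n (fiberOver f s) p)
    (H : Subgroup (FundamentalGroup (Set.univ : Set (ComplexPoints S)) ⟨s, Set.mem_univ s⟩))
    [H.FiniteIndex]
    (hH : ∀ γ ∈ H, transportFun f (2 * p) hU (FundamentalGroup.toPath γ) T = T)
    (γ : FundamentalGroup (Set.univ : Set (ComplexPoints S)) ⟨s, Set.mem_univ s⟩) :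
    transportFun f (2 * p) hU (FundamentalGroup.toPath γ) T ∈ motivatedClasses n (fiberOver f s) p :=
  transportFun_mem_motivatedClasses_of_finiteIndex' hGIC h05 f hf hι hS hU hT H hH s
    (FundamentalGroup.toPath γ)

/-- **André 1996, Cor. 5.1, stated with flat continuations, granted only
`deligne_globalInvariantCycles` and `Andre1996_deformation`** — the tree's
`mem_motivatedClasses_of_isContinuationAlong_of_finiteIndex` without `hRE`. Same hypotheses on `f`,
`S`, `s`, `T` as `transportFun_mem_motivatedClasses_of_finiteIndex'`, invariance and conclusion
phrased with the witness-free `IsContinuationAlong` of `HodgeTheory/HodgeLocus` (for smooth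
projective families this IS parallel transport, `isContinuationAlong_iff_transportFun_eq`): if
`T ∈ A_motᵖ(X_s)_ℂ` is its own continuation along every loop at `s` whose class lies in a
finite-index subgroup `H ≤ π₁(S(ℂ), s)`, then every flat continuation `β` of `T` along any path from
`s` to any `t ∈ S(ℂ)` is motivated.
[cite: Andre1996Motifs, Cor. 5.1 and its proof (p. 26)] [cite: SGA1, Exp. XII Thm. 5.1]
[cite: DeligneHodgeII1971, Théorème 4.1.1] -/
theorem mem_motivatedClasses_of_isContinuationAlong_of_finiteIndex'
    (hGIC : deligne_globalInvariantCycles) (h05 : Andre1996_deformation)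
    {n : ℕ} {𝒳 S : SchemeOver ℂ} (f : 𝒳 ⟶ S) (hf : IsSmoothProjectiveFamily f n)
    (hι : ∃ (N : ℕ) (ι : 𝒳 ⟶ projectiveSpace N ℂ ⊗ S),
      IsClosedImmersion ι.left ∧ ι ≫ CartesianMonoidalCategory.snd (projectiveSpace N ℂ) S = f)
    (hS : IsQuasiProjectiveOver S) [Smooth S.hom] [IrreducibleSpace S.left]
    {s : ComplexPoints S} {p : ℕ} {T : complexBetti (fiberOver f s) (2 * p)}
    (hT : T ∈ motivatedClasses n (fiberOver f s) p)
    (H : Subgroup (FundamentalGroup (Set.univ : Set (ComplexPoints S)) ⟨s, Set.mem_univ s⟩))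
    [H.FiniteIndex]
    (hH : ∀ γ : Path s s,
      FundamentalGroup.fromPath
          (⟦γ.map (continuous_id.subtype_mk fun x ↦ Set.mem_univ x)⟧ :
            Path.Homotopic.Quotient (⟨s, Set.mem_univ s⟩ : (Set.univ : Set (ComplexPoints S)))
              ⟨s, Set.mem_univ s⟩) ∈ H →
        IsContinuationAlong γ T T)
    {t : ComplexPoints S} (γ : Path s t) {β : complexBetti (fiberOver f t) (2 * p)}
    (hβ : IsContinuationAlong γ T β) : β ∈ motivatedClasses n (fiberOver f t) p := by
  -- `R²ᵖ f_* ℂ` is a local system on `S(ℂ)` (Ehresmann, proved for such families)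
  obtain ⟨d, hd⟩ := Motives.exists_smoothOfRelativeDimension_of_smooth S.hom
  haveI := hd
  have hU := isCohomologicallyLocallyTrivialOn_univ_of_isSmoothProjectiveFamily f d hf hS
  -- invariance under `H` in transport form
  have hH' : ∀ δ ∈ H, transportFun f (2 * p) hU (FundamentalGroup.toPath δ) T = T := by
    intro δ hδ
    obtain ⟨δ₀, hδ₀⟩ := Quotient.exists_rep (FundamentalGroup.toPath δ)
    -- the loop `δ₀` read in `S(ℂ)` and back in the subtype `univ` is `δ₀` (definitionally)
    have hq : (⟦(δ₀.map continuous_subtype_val).map (continuous_id.subtype_mk fun x ↦ Set.mem_univ x)⟧ :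
        Path.Homotopic.Quotient (⟨s, Set.mem_univ s⟩ : (Set.univ : Set (ComplexPoints S)))
          ⟨s, Set.mem_univ s⟩) = FundamentalGroup.toPath δ := hδ₀
    have hmem : FundamentalGroup.fromPath
        (⟦(δ₀.map continuous_subtype_val).map (continuous_id.subtype_mk fun x ↦ Set.mem_univ x)⟧ :
          Path.Homotopic.Quotient (⟨s, Set.mem_univ s⟩ : (Set.univ : Set (ComplexPoints S)))
            ⟨s, Set.mem_univ s⟩) ∈ H := by
      rw [hq]
      exact hδ
    have hc := (isContinuationAlong_iff_transportFun_eq f (2 * p) hU (s := s) (t := s)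
      (δ₀.map continuous_subtype_val) T T).1 (hH _ hmem)
    rw [hq] at hc
    exact hc
  -- the continuation `β` is the transport of `T` along `γ`
  have hβ' := (isContinuationAlong_iff_transportFun_eq f (2 * p) hU (s := s) (t := t) γ T β).1 hβ
  rw [← hβ']
  exact transportFun_mem_motivatedClasses_of_finiteIndex' hGIC h05 f hf hι hS hU hT H hH' t _

end Literature.AlgebraicGeometry.Andre1996

end
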